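import Summits.MatrixMultiplication.OmegaCensus.STPPSmallPatternSquareProducts
import Summits.MatrixMultiplication.OmegaCensus.STPPTricoloredCoprime

/-!
# ω-census, `(1,2,2)^k` in prime-power squares `(ℤ/n)²` for `25 ≤ k ≤ 32`

HONEST FRAMING (pub-omega census; verbatim): lottery ticket; floor = certified bounds/negative ranges.
Census STRUCTURE bookkeeping of the STPP track (seat pub-omega-stpp-3, gen 30; square seeds of the `(1,2,2)^k` laws for `k ≥ 25`), not progress on `ω`.

The square seeds `(ℤ/n)²` (`n` a prime power) of every `(1,2,2)^k` law with `k ≤ 24` come from `exists_isSTPP_122pow24_zmod_sq` (`(1,2,2)³ ⊆ ℤ/n`, `n ≥ 24`, times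
the 8-element TSF of `ℤ/n`, `n ≥ 27`).  For `k ≥ 25`:

* `exists_isSTPP_122pow32_zmod_sq` — **`(1,2,2)³² ⊆ (ℤ/n)²` for every `n ≥ 33`** (`(1,2,2)⁴ ⊆ ℤ/n`, cyclic onset `33`, times the TSF of size `8`);
* `exists_isTSF_nine_zmod31`, `exists_isTSF_nine_zmod32` — tricolored sum-free sets of size `9` in `ℤ/31` and `ℤ/32` (found by g29's complete-search tool
  `code/tsf/tsfc.c` in `< 1 s`; general colourings, not of the form `(x, x, −2x)`: `ℤ/31` has NO 9-element 3-term-progression-free subset), hence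
  `exists_isSTPP_122pow27_zmod31_sq`, `exists_isSTPP_122pow27_zmod32_sq` — **`(1,2,2)²⁷ ⊆ (ℤ/31)²` and `⊆ (ℤ/32)²`** (`(1,2,2)³ ⊆ ℤ/n` times the TSF of size `9`).

`(ℤ/29)²` (order 841) has no known `(1,2,2)²⁵` family (`TSF(ℤ/29) ≥ 9` undecided within 280 s); `(ℤ/31)²`, `(ℤ/32)²` are open at `k = 28`.  No maximality is claimed for the TSFs.

References: H. Cohn, R. Kleinberg, B. Szegedy, C. Umans, FOCS 2005 (arXiv:math/0511460), Def. 5.1; Blasiak–Church–Cohn–Grochow–Naslund–Sawin–Umans,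
Discrete Analysis 2017:3, Def. 3.1 (tricolored sum-free sets).
-/

open Literature.Computability.AlgebraicComplexity Literature.Combinatorics.Additive Finset

namespace Summit.MatrixMultiplication.OmegaCensus

/-- **`(1,2,2)³² ⊆ ℤ/n × ℤ/n` for every `n ≥ 33`** (`(1,2,2)⁴ ⊆ ℤ/n` for `n ≥ 33` times the 8-element TSF of `ℤ/n`, `n ≥ 27`): the prime-power squares `(ℤ/q)²`, `q ≥ 37`,
of the `(1,2,2)^k` laws with `25 ≤ k ≤ 32`. [cite: CohnKleinbergSzegedyUmans2005, Def. 5.1] -/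
theorem exists_isSTPP_122pow32_zmod_sq (n : ℕ) (hn : 33 ≤ n) :
    ∃ A B C : Fin 32 → Finset (ZMod n × ZMod n), IsSTPP A B C ∧ ∀ i, (A i).card = 1 ∧ (B i).card = 2 ∧ (C i).card = 2 :=
  exists_isSTPP_122pow_mul_eight_zmod_sq (a := 4) (by omega) (exists_isSTPP_122pow4_zmod_of_le n hn)

/-- `ℤ/31` carries a tricolored sum-free set of size 9 (complete-search tool `tsfc`, general colouring; kernel re-decision). -/
theorem exists_isTSF_nine_zmod31 : ∃ s t u : Fin 9 → ZMod 31, IsTricoloredSumFree s t u :=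
  ⟨![0, 1, 3, 4, 7, 9, 15, 17, 24], ![0, 1, 3, 10, 15, 17, 8, 12, 4], ![0, 29, 25, 17, 9, 5, 8, 2, 3], by unfold IsTricoloredSumFree; decide⟩

/-- `ℤ/32` carries a tricolored sum-free set of size 9 (complete-search tool `tsfc`, general colouring; kernel re-decision). -/
theorem exists_isTSF_nine_zmod32 : ∃ s t u : Fin 9 → ZMod 32, IsTricoloredSumFree s t u :=
  ⟨![0, 1, 3, 4, 15, 21, 24, 26, 28], ![0, 1, 3, 7, 26, 24, 25, 18, 27], ![0, 30, 26, 21, 23, 19, 15, 20, 9], by unfold IsTricoloredSumFree; decide⟩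

/-- **`(1,2,2)²⁷ ⊆ ℤ/31 × ℤ/31`** (`(1,2,2)³ ⊆ ℤ/31` times the 9-element TSF of `ℤ/31`). [cite: CohnKleinbergSzegedyUmans2005, Def. 5.1] -/
theorem exists_isSTPP_122pow27_zmod31_sq :
    ∃ A B C : Fin 27 → Finset (ZMod 31 × ZMod 31), IsSTPP A B C ∧ ∀ i, (A i).card = 1 ∧ (B i).card = 2 ∧ (C i).card = 2 := by
  obtain ⟨σ, τ, υ, hT⟩ := exists_isTSF_nine_zmod31
  exact exists_isSTPP_cards_mul_of_tsf (exists_isSTPP_122pow3_zmod_of_le 31 (by norm_num)) hT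

/-- **`(1,2,2)²⁷ ⊆ ℤ/32 × ℤ/32`** (`(1,2,2)³ ⊆ ℤ/32` times the 9-element TSF of `ℤ/32`). [cite: CohnKleinbergSzegedyUmans2005, Def. 5.1] -/
theorem exists_isSTPP_122pow27_zmod32_sq :
    ∃ A B C : Fin 27 → Finset (ZMod 32 × ZMod 32), IsSTPP A B C ∧ ∀ i, (A i).card = 1 ∧ (B i).card = 2 ∧ (C i).card = 2 := by
  obtain ⟨σ, τ, υ, hT⟩ := exists_isTSF_nine_zmod32
  exact exists_isSTPP_cards_mul_of_tsf (exists_isSTPP_122pow3_zmod_of_le 32 (by norm_num)) hT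

end Summit.MatrixMultiplication.OmegaCensus
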